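import Summits.QuantumFields.YangMills.Theorems.BalabanUVNodesN15DefectKernelVectorPiece
import Summits.QuantumFields.YangMills.Theorems.BalabanUVNodesN15DefectKernelTowerSlack
import Literature.MathematicalPhysics.QuantumFieldTheory.Balaban1983to89.B6UnitTorusCarrier
import HarnessLib

/-!
# Route «BalabanUVNodes» (K4 «SpineRates»), node N15 = NE2, THE -a ∕ -b INTERFACE OF THE BACKGROUND LAYER, part 10: THE SINGLE-SCALE PIECES ON
# THE CONCRETE UNIT-TORUS CARRIER — every GEOMETRIC binder of parts 7b and 9 DISCHARGED (non-vacuity with `O(1)`, volume-uniform constants)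

Cell `pub-ymgap`, seat `pub-ymgap-dag-n15-a` (KNIT-BY-NAME, generation g3; HUMAN RULING D-0062; chair R424 venue; `bears_on: R4∕N15`).  Filed
`--supports stmt-QuantumFields-19351` (helper).  THEOREMS ONLY; imports BY NAME, nothing in the tree modified: part 9 `…DefectKernelVectorPiece`
(`hasMaj_idef_vectorPiece`), part 7b `…DefectKernelTowerSlack` (`hasMaj_idef_kingPiece_blocks`), and the carrier module
`Literature/…/Balaban1983to89/B6UnitTorusCarrier` (this seat g3: the one-scale [B6] carrier `unitTorusGeo L k M` — sites = the unit torus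
`Π_ν ℤ∕M_ν`, distance = King's periodic sup-distance `tdistT` — with its (2.54) `triangle254_unitTorusGeo`, (2.61) `rowSum_unitTorusGeo`
(uniform in the volume), the bond-assignment block counts `card_fibre_unitBond = d + 1`, `card_fibre_fineBond = (d + 1)·n^{d+1}`, and the
dictionary `pdist_rep_rep : ρ_M(rep y, rep y′) = |y − y′|_T`).

WHY (g2 HANDOFF §g2.3 (d) «the two dominance binders are the consumer's geometry (unit cubes + physical sup distance make them true with κ = O(1))»;
dag-ref-B's standing vacuity checks A1–A6).  Parts 5–9 state the single-scale pieces for ANY [B6] carrier `g`, ANY site assignments and ANY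
dominated distance — binders.  THIS FILE instantiates them on the HONEST concrete carrier of the torus model: `g = unitTorusGeo L k M`, unit bonds
assigned to their base point (`nΩ = d + 1`), fine bonds to King's unit block of their base point (`n_η = (d + 1)·(L^k)^{d+1}`, Riemann balance
`n_η·w = d + 1` at `w = L^{−k(d+1)}`), the H-dominance with EQUALITY at `δ = δ_H = κ₁₆₃(d+1)∕(d+1)`, the C-dominance with EQUALITY at `δ_C = δ′`
through the canonical indexing `e(y, λ) = (rep y, λ)` of unit bonds by box representatives, (2.61) at `σ_r = min(δ_H, δ′)∕2` with
`c_r = K_{d+1}(σ_r)` INDEPENDENT OF THE VOLUME — so that the ONLY binders left are the operators read off by their entries (inhabited: part 8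
`exists_reHkLin`, part 2 `exists_kingProj`) and a rate `0 ≤ ρ ≤ min(δ_H, δ′)∕2`.

CONTENTS.  §1 **`hasMaj_idef_vectorPiece_unitTorus`** — part 9 on the concrete carrier: for `d + 1 ≥ 2`, `L ≥ 1` there are `B₀, C₁, δ′ > 0` such
that for every unit torus with `L ∣ M_ν`, all `k`, `m ≥ 1`, Bałaban's `H_k`, `H_{k+m}` (entries), their Riemann transposes, the (2.156) covariances
(entries through `e`), King's pairing, and every `0 ≤ ρ ≤ min(δ_H, δ′)∕2`: `𝔇(H′C′K′, HCK)` has the EXPLICIT block majorant displayed in the statement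
times `e^{−ρ|y − y′|_T}` between the sharp cube norms of the fine-bond assignments.  §2 **`hasMaj_idef_kingPiece_unitTorus`** — part 7b's
`hasMaj_idef_kingPiece_blocks` (King's scalar `A = 0` piece on Bałaban's volumes) on the same kind of carrier (`unitTorusGeo` of the unit torus
`Π ℤ∕(LM_ν)`, sites assigned to themselves, fine points to King's block, both unit-torus dominances with EQUALITY `κ = 1`, `δ_C = δ₄₅`).

HONEST FRAMING ∕ LIMITS.  Instantiation only (no new estimate): the `U = 1` linear theory on finite tori, one single-scale piece in King's SHAPE;
constants explicit, crude, volume-independent; NOT [B6]'s multiscale expansion (NODE 00), nothing with background (NE2⁺ NOT PRINTED ∕ not proved);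
count-neutral (typed 28∕28 · discharged unchanged); NOT a discharge of N15; one finite T⁴ at fixed ε — NOT infinite volume, NOT OS on ℝ⁴, NOT a mass
gap, NOT Clay.
-/

noncomputable section

open scoped BigOperators
open Finset

namespace Summit.QuantumFields.YangMills.BalabanUVNodes.N15.DefectKernel

open Literature.MathematicalPhysics.QuantumFieldTheory.Balaban1983to89
open Literature.MathematicalPhysics.QuantumFieldTheory.Balaban1983to89.B11SectG (BlockNorm HasMaj RowSum)
open Literature.MathematicalPhysics.QuantumFieldTheory.Balaban1983to89.T4EtaRateDefect (idef)
open Literature.MathematicalPhysics.QuantumFieldTheory.Balaban1983to89.T4EtaRateCoeffDefect (pull fibre)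
open Literature.MathematicalPhysics.QuantumFieldTheory.Balaban1983to89.B4TorusKernel (periodConst)
open Literature.MathematicalPhysics.QuantumFieldTheory.Balaban1983to89.B5Prop11Plancherel (Tor fine)
open Literature.MathematicalPhysics.QuantumFieldTheory.Balaban1983to89.B5Hk163Strip (kappa163 kappa163_pos)
open Literature.MathematicalPhysics.QuantumFieldTheory.Balaban1983to89.B5Hk163Decay (MG163)
open Literature.MathematicalPhysics.QuantumFieldTheory.Balaban1983to89.B5Hk163Torus (HkOp)
open Literature.MathematicalPhysics.QuantumFieldTheory.Balaban1983to89.B5Hk163TorusHolderDecay (MD163)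
open Literature.MathematicalPhysics.QuantumFieldTheory.Balaban1983to89.T4Hk163StripRate (CGe)
open Literature.MathematicalPhysics.QuantumFieldTheory.Balaban1983to89.B6LowerBound2153Torus (rep rep_mem_pbox)
open Literature.MathematicalPhysics.QuantumFieldTheory.Balaban1983to89.B6Lemma24Torus (pbox)
open Literature.MathematicalPhysics.QuantumFieldTheory.Balaban1983to89.B6BondEliminationTorus (pdist)
open Literature.MathematicalPhysics.QuantumFieldTheory.Balaban1983to89.B6Cov2156Torus (deltaPol bondReductionT one_le_M)
open Literature.MathematicalPhysics.QuantumFieldTheory.Balaban1983to89.B6UnitTorusCarrier (unitTorusGeo triangle254_unitTorusGeo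
  unitTorusGeo_dist_nonneg unitTorusGeo_dist_symm rowSum_unitTorusGeo card_fibre_unitBond card_fibre_fineBond card_fibre_blockOf pdist_rep_rep)
open Literature.MathematicalPhysics.QuantumFieldTheory.King1986 (aK prop38RateConst prop38PosConst lemma43Const)
open Literature.MathematicalPhysics.QuantumFieldTheory.King1986.Torus (blockOf tdistT minimiser effLaplacian blockProj K45 delta45 gam0L)

variable {d : ℕ}

/-! ## §1 The vector single-scale piece on the concrete unit-torus carrier -/

/-- **THE VECTOR SINGLE-SCALE PIECE ON THE CONCRETE CARRIER — every geometric binder of part 9 discharged.**  For `d + 1 ≥ 2`, `L ≥ 1` there are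
`B₀, C₁, δ′ > 0` (the (2.156) lineage's) such that for every unit torus `Π_ν ℤ∕M_ν` with `L ∣ M_ν`, all levels `k`, `m ≥ 1`, Bałaban's typed `H_k`,
`H_{k+m}` read off as real linear maps by their entries, their Riemann transposes `K = w·H_kᵀ`, `K′ = (w∕(L^m)^{d+1})·H_{k+m}ᵀ` (`w ≥ 0`), the (2.156)
covariances `C^{(k)}`, `C^{(k+m)}` read off by their entries through the CANONICAL indexing `(y, λ) ↦ (rep y, λ)` of unit bonds, King's pairing
`pr`∕`prV`, and every rate `0 ≤ ρ ≤ min(δ_H, δ′)∕2` (`δ_H = κ₁₆₃(d+1)∕(d+1)`): on the carrier `unitTorusGeo L k M` with the fine bonds assigned to the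
unit block of their base point, `𝔇(H′C′K′, HCK)` through (pull, pull) has the displayed EXPLICIT block majorant times `e^{−ρ|y − y′|_T}` —
`nΩ = d + 1`, `n_η = (d + 1)(L^k)^{d+1}`, `c_r = K_{d+1}(min(δ_H, δ′)∕2)` (volume-independent), `c₀ = MG163·periodConst`, `R_H = C_H∕L^k`, `R_C = C₁L^{−k}`.
[cite: King1986, (4.42)–(4.43) p.675 (mechanism); Balaban1984PropagatorsI, (1.63) p.28; Balaban1984PropagatorsII, (2.156) p.250, (2.54) p.233, Lemma 2.1 (2.61) p.234] -/
theorem hasMaj_idef_vectorPiece_unitTorus (hd : 1 ≤ d) {L : ℕ} [NeZero L] (hL : 1 ≤ L) :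
    ∃ B₀ C₁ δ' : ℝ, 0 < B₀ ∧ 0 < C₁ ∧ 0 < δ' ∧ ∀ (M : Fin (d + 1) → ℕ) [∀ μ, NeZero (M μ)] (_ : ∀ i, L ∣ M i)
      (k m : ℕ) (_ : 1 ≤ m)
      (pr : Tor (fine (L ^ m * L ^ k) M) → Tor (fine (L ^ k) M)) (_ : ∀ x' μ, (pr x' μ).val = (x' μ).val / L ^ m)
      (prV : Tor (fine (L ^ m * L ^ k) M) × Fin (d + 1) → Tor (fine (L ^ k) M) × Fin (d + 1))
      (_ : ∀ i, prV i = (pr i.1, i.2))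
      (H : (Tor M × Fin (d + 1) → ℝ) →ₗ[ℝ] (Tor (fine (L ^ k) M) × Fin (d + 1) → ℝ))
      (_ : ∀ b i, H (Pi.single b 1) i = (HkOp (L ^ k) M i b).re)
      (H' : (Tor M × Fin (d + 1) → ℝ) →ₗ[ℝ] (Tor (fine (L ^ m * L ^ k) M) × Fin (d + 1) → ℝ))
      (_ : ∀ b i, H' (Pi.single b 1) i = (HkOp (L ^ m * L ^ k) M i b).re)
      {w : ℝ} (_ : 0 ≤ w) (K : (Tor (fine (L ^ k) M) × Fin (d + 1) → ℝ) →ₗ[ℝ] (Tor M × Fin (d + 1) → ℝ))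
      (_ : ∀ i b, K (Pi.single i 1) b = w * H (Pi.single b 1) i)
      (K' : (Tor (fine (L ^ m * L ^ k) M) × Fin (d + 1) → ℝ) →ₗ[ℝ] (Tor M × Fin (d + 1) → ℝ))
      (_ : ∀ i' b, K' (Pi.single i' 1) b = w / ((L : ℝ) ^ m) ^ (d + 1) * H' (Pi.single b 1) i')
      (C : (Tor M × Fin (d + 1) → ℝ) →ₗ[ℝ] (Tor M × Fin (d + 1) → ℝ))
      (_ : ∀ b b', C (Pi.single b' 1) b =
        (bondReductionT L M (deltaPol M (L ^ k))).cov (⟨rep M b.1, rep_mem_pbox M b.1⟩, b.2) (⟨rep M b'.1, rep_mem_pbox M b'.1⟩, b'.2))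
      (C' : (Tor M × Fin (d + 1) → ℝ) →ₗ[ℝ] (Tor M × Fin (d + 1) → ℝ))
      (_ : ∀ b b', C' (Pi.single b' 1) b =
        (bondReductionT L M (deltaPol M (L ^ (k + m)))).cov (⟨rep M b.1, rep_mem_pbox M b.1⟩, b.2) (⟨rep M b'.1, rep_mem_pbox M b'.1⟩, b'.2))
      {ρ : ℝ} (_ : 0 ≤ ρ) (_ : ρ ≤ min (kappa163 (d + 1) / (d + 1)) δ' / 2),
      HasMaj (BlockNorm.ofBlocks (unitTorusGeo L k M) (fun i : Tor (fine (L ^ k) M) × Fin (d + 1) => blockOf (L ^ k) M i.1))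
        (BlockNorm.ofBlocks (unitTorusGeo L k M)
          ((fun i : Tor (fine (L ^ k) M) × Fin (d + 1) => blockOf (L ^ k) M i.1) ∘ prV))
        (idef (pull prV) (pull prV) (H' ∘ₗ (C' ∘ₗ K')) (H ∘ₗ (C ∘ₗ K)))
        (fun y y' =>
          (((d + 1 : ℕ) : ℝ) * (MG163 (d + 1) * periodConst (kappa163 (d + 1)) d) *
                B4Sect5Proof.latticeConst (d + 1) (min (kappa163 (d + 1) / (d + 1)) δ' / 2) *
              (((d + 1 : ℕ) : ℝ) * B₀ * B4Sect5Proof.latticeConst (d + 1) (min (kappa163 (d + 1) / (d + 1)) δ' / 2) *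
                  ((((d + 1) * (L ^ k) ^ (d + 1) : ℕ) : ℝ) * w *
                    ((CGe (d + 1) + (d + 1) * MD163 (d + 1)) * periodConst (kappa163 (d + 1)) d / ((L ^ k : ℕ) : ℝ)))
                + ((d + 1 : ℕ) : ℝ) * (C₁ * ((L : ℝ) ^ k)⁻¹) *
                    B4Sect5Proof.latticeConst (d + 1) (min (kappa163 (d + 1) / (d + 1)) δ' / 2) *
                  ((((d + 1) * (L ^ k) ^ (d + 1) : ℕ) : ℝ) * w * (MG163 (d + 1) * periodConst (kappa163 (d + 1)) d)))
            + ((d + 1 : ℕ) : ℝ) * ((CGe (d + 1) + (d + 1) * MD163 (d + 1)) * periodConst (kappa163 (d + 1)) d / ((L ^ k : ℕ) : ℝ)) *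
                B4Sect5Proof.latticeConst (d + 1) (min (kappa163 (d + 1) / (d + 1)) δ' / 2) *
              (((d + 1 : ℕ) : ℝ) * B₀ * B4Sect5Proof.latticeConst (d + 1) (min (kappa163 (d + 1) / (d + 1)) δ' / 2) *
                ((((d + 1) * (L ^ k) ^ (d + 1) : ℕ) : ℝ) * w * (MG163 (d + 1) * periodConst (kappa163 (d + 1)) d)))) *
          Real.exp (-(ρ * tdistT M y y'))) := by
  obtain ⟨B₀, C₁, δ', hB₀, hC₁, hδ', HP⟩ := hasMaj_idef_vectorPiece (d := d) hd hL
  refine ⟨B₀, C₁, δ', hB₀, hC₁, hδ', ?_⟩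
  intro M _ hLM k m hm pr hpr prV hprV H hH H' hH' w hw0 K hK K' hK' C hC C' hC' ρ hρ hρ'
  have hσ : 0 < min (kappa163 (d + 1) / (d + 1)) δ' / 2 :=
    half_pos (lt_min (div_pos (kappa163_pos _) (by positivity)) hδ')
  have hmin₁ : min (kappa163 (d + 1) / (d + 1)) δ' ≤ kappa163 (d + 1) / (d + 1) := min_le_left _ _
  have hmin₂ : min (kappa163 (d + 1) / (d + 1)) δ' ≤ δ' := min_le_right _ _
  exact HP M hLM k m hm (g := unitTorusGeo L k M) (triangle254_unitTorusGeo L k M) (unitTorusGeo_dist_nonneg L k M)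
    (unitTorusGeo_dist_symm L k M) hσ.le (rowSum_unitTorusGeo L k M hσ)
    (fun b : Tor M × Fin (d + 1) => b.1) (fun y' => (card_fibre_unitBond M y').le)
    (fun i : Tor (fine (L ^ k) M) × Fin (d + 1) => blockOf (L ^ k) M i.1) (fun y' => (card_fibre_fineBond (L ^ k) M y').le)
    pr hpr prV hprV H hH H' hH' hw0 K hK K' hK'
    (fun b : Tor M × Fin (d + 1) => ((⟨rep M b.1, rep_mem_pbox M b.1⟩, b.2) : B4.Idx (pbox M) (d + 1))) C hC C' hC'
    (δ := kappa163 (d + 1) / (d + 1)) (fun b i => le_rfl)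
    (δC := δ') (fun b b' => by rw [pdist_rep_rep])
    hρ (by linarith) (by linarith)

/-! ## §2 King's scalar single-scale piece on the concrete unit-torus carrier -/

/-- The fibre of the identity assignment is a singleton. [folklore] -/
theorem card_fibre_id {X : Type} [Fintype X] [DecidableEq X] (y : X) : (fibre (fun x : X => x) y).card = 1 := by
  have h : fibre (fun x : X => x) y = {y} := by
    ext x
    simp only [T4EtaRateCoeffDefect.mem_fibre, Finset.mem_singleton]
  rw [h, Finset.card_singleton]

/-- **KING'S SCALAR SINGLE-SCALE PIECE (part 7b) ON THE CONCRETE CARRIER — both unit-torus dominances with EQUALITY.**  Part 7b's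
`hasMaj_idef_kingPiece_blocks` for the volume `P = (d + 1, L, mm, K)` on `g = unitTorusGeo L′ kk (Π ℤ∕(LM_ν))` (the unit torus of King's setting as
the one-scale [B6] carrier; unit sites assigned to themselves, `nΩ = 1`; fine points to King's unit block, `n_η = (L^K)^{d+1}`), the C-dominance at
`δ_C = δ₄₅` and the minimiser dominance at `κ = 1` BOTH WITH EQUALITY, (2.61) at any `σ_r > 0` with the volume-independent `c_r = K_{d+1}(σ_r)`: the
only binders left are King's operators read off as linear maps and the rate window `ρ + σ_r ≤ δ₀∕2`, `ρ + σ_r ≤ δ₄₅`.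
[cite: King1986, (4.42)–(4.43) p.675; Prop. 3.8 (3.71) p.664; Lemma 4.5 (4.38) p.674; Theorem 3.3 p.658; Balaban1984PropagatorsII, (2.54) p.233, Lemma 2.1 (2.61) p.234] -/
theorem hasMaj_idef_kingPiece_unitTorus (L : ℕ) [NeZero L] (hL : Odd L ∧ 1 < L) {a m2 : ℝ} (ha : 0 < a) (hm : 0 < m2)
    {γ : ℝ} (hγ0 : 0 ≤ γ) (hγ1 : γ ≤ 1) :
    ∃ δ₀ c₀ : ℝ, 0 < δ₀ ∧ 0 < c₀ ∧ ∀ (mm K : ℕ) (_ : 1 ≤ K) (n : ℕ) (_ : 1 ≤ n) (M : Fin (d + 1) → ℕ) [∀ μ, NeZero (M μ)]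
      (_ : ∀ μ, fine L M μ = (⟨d + 1, L, mm, K, Nat.le_add_left 1 d, hL⟩ : Params).sitesPerDir K)
      (L' kk : ℕ) {σr : ℝ} (_ : 0 < σr)
      (pr : Tor (fine (L ^ n * L ^ K) (fine L M)) → Tor (fine (L ^ K) (fine L M)))
      (_ : ∀ x' μ, (pr x' μ).val = (x' μ).val / L ^ n)
      (H : (Tor (fine L M) → ℝ) →ₗ[ℝ] (Tor (fine (L ^ K) (fine L M)) → ℝ))
      (_ : ∀ φ, H φ = minimiser (L ^ K) (fine L M) (aK a L K) (((L ^ K : ℕ) : ℝ) ^ 2) m2 φ)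
      (H' : (Tor (fine L M) → ℝ) →ₗ[ℝ] (Tor (fine (L ^ n * L ^ K) (fine L M)) → ℝ))
      (_ : ∀ φ, H' φ = minimiser (L ^ n * L ^ K) (fine L M) (aK a L (K + n)) (((L ^ n * L ^ K : ℕ) : ℝ) ^ 2) m2 φ)
      {w : ℝ} (_ : 0 ≤ w) (Kt : (Tor (fine (L ^ K) (fine L M)) → ℝ) →ₗ[ℝ] (Tor (fine L M) → ℝ))
      (_ : ∀ x b, Kt (Pi.single x 1) b = w * H (Pi.single b 1) x)
      (Kt' : (Tor (fine (L ^ n * L ^ K) (fine L M)) → ℝ) →ₗ[ℝ] (Tor (fine L M) → ℝ))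
      (_ : ∀ x' b, Kt' (Pi.single x' 1) b = w / ((L : ℝ) ^ n) ^ (d + 1) * H' (Pi.single b 1) x')
      {ρ : ℝ} (_ : 0 ≤ ρ) (_ : ρ + σr ≤ δ₀ * 1 / 2) (_ : ρ + σr ≤ delta45 (d + 1) a L),
      HasMaj (BlockNorm.ofBlocks (unitTorusGeo L' kk (fine L M)) (fun xt : Tor (fine (L ^ K) (fine L M)) => blockOf (L ^ K) (fine L M) xt))
        (BlockNorm.ofBlocks (unitTorusGeo L' kk (fine L M))
          ((fun xt : Tor (fine (L ^ K) (fine L M)) => blockOf (L ^ K) (fine L M) xt) ∘ pr))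
        (idef (pull pr) (pull pr)
          (H' ∘ₗ (Matrix.mulVecLin (effLaplacian (L ^ n * L ^ K) (fine L M) (aK a L (K + n))
              (((L ^ n * L ^ K : ℕ) : ℝ) ^ 2) m2 + (a * ((L : ℝ) ^ 2)⁻¹) • blockProj L M)⁻¹ ∘ₗ Kt'))
          (H ∘ₗ (Matrix.mulVecLin (effLaplacian (L ^ K) (fine L M) (aK a L K) (((L ^ K : ℕ) : ℝ) ^ 2) m2
              + (a * ((L : ℝ) ^ 2)⁻¹) • blockProj L M)⁻¹ ∘ₗ Kt)))
        (fun y y' =>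
          (((1 : ℕ) : ℝ) * (a * c₀) * B4Sect5Proof.latticeConst (d + 1) σr *
              (((1 : ℕ) : ℝ) * (2 / gam0L (d + 1) a L) * B4Sect5Proof.latticeConst (d + 1) σr *
                  ((((L ^ K) ^ (d + 1) : ℕ) : ℝ) * w * Real.sqrt ((prop38RateConst a a (lemma43Const a L K n) ((Real.pi ^ 2 / 4) ^ (d + 1)) (d + 1) γ
                    + prop38PosConst a ((Real.pi ^ 2 / 4) ^ (d + 1)) (d + 1) γ) * ((L ^ K : ℕ) : ℝ) ^ (-γ) * (2 * (a * c₀))))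
                + ((1 : ℕ) : ℝ) * (K45 (d + 1) a L * ((L : ℝ) ^ K)⁻¹) * B4Sect5Proof.latticeConst (d + 1) σr * ((((L ^ K) ^ (d + 1) : ℕ) : ℝ) * w * (a * c₀)))
            + ((1 : ℕ) : ℝ) * Real.sqrt ((prop38RateConst a a (lemma43Const a L K n) ((Real.pi ^ 2 / 4) ^ (d + 1)) (d + 1) γ
                  + prop38PosConst a ((Real.pi ^ 2 / 4) ^ (d + 1)) (d + 1) γ) * ((L ^ K : ℕ) : ℝ) ^ (-γ) * (2 * (a * c₀))) * B4Sect5Proof.latticeConst (d + 1) σr *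
              (((1 : ℕ) : ℝ) * (2 / gam0L (d + 1) a L) * B4Sect5Proof.latticeConst (d + 1) σr * ((((L ^ K) ^ (d + 1) : ℕ) : ℝ) * w * (a * c₀)))) *
          Real.exp (-(ρ * tdistT (fine L M) y y'))) := by
  obtain ⟨δ₀, c₀, hδ₀, hc₀, H7⟩ := hasMaj_idef_kingPiece_blocks (d + 1) L (Nat.le_add_left 1 d) hL ha hm hγ0 hγ1
  refine ⟨δ₀, c₀, hδ₀, hc₀, ?_⟩
  intro mm K hK n hn M _ hMK L' kk σr hσr pr hpr H hH H' hH' w hw0 Kt hKt Kt' hKt' ρ hρ hρ₁ hρ₂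
  exact H7 ⟨d + 1, L, mm, K, Nat.le_add_left 1 d, hL⟩ rfl rfl hK n hn M hMK (g := unitTorusGeo L' kk (fine L M))
    (triangle254_unitTorusGeo L' kk (fine L M)) (unitTorusGeo_dist_nonneg L' kk (fine L M))
    (unitTorusGeo_dist_symm L' kk (fine L M)) hσr.le (rowSum_unitTorusGeo L' kk (fine L M) hσr)
    (fun bt : Tor (fine L M) => bt) (fun y' => (card_fibre_id y').le)
    (fun xt : Tor (fine (L ^ K) (fine L M)) => blockOf (L ^ K) (fine L M) xt) (fun y' => (card_fibre_blockOf (L ^ K) (fine L M) y').le)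
    pr hpr H hH H' hH' hw0 Kt hKt Kt' hKt' (δC := delta45 (d + 1) a L) (fun x z => le_rfl) (κ := 1) one_pos
    (fun bt xt => le_of_eq (one_mul _)) hρ hρ₁ hρ₂

/-! ## §3 The (3.73)-shaped pointwise reading of a block majorant through King's pairing -/

/-- **KING'S (3.73) FIRST-LINE SHAPE, READ OFF A BLOCK MAJORANT.**  If `𝔇(P′, P)` through (pull `π₁` on sources, pull `π₂` on observations) has the block
majorant `K` between the sharp cube norms of `blk₁`, `blk₂`, then for every source point `z` and every fine observation point `x′`:
`|Σ_{z′ over z} P′(x′, z′) − P(π₂x′, z)| ≤ K(blk₂ x′, blk₁ z)` — the block-summed fine kernel against the coarse kernel at the paired point, King's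
«|G^{η′}(x′, B^n(y)) − G^η(x, y)| ≤ …» display (part 1's `entry_le_of_hasMaj` + `idef_pull_pull_single_apply`).  Applied to §1∕§2 it turns their `HasMaj`
conclusions into pointwise `e^{−ρ|B(x′) − B(z)|_T}` bounds with the displayed constants. [cite: King1986, Prop. 3.9 (3.73) p.665 (shape)] -/
theorem abs_blockSum_sub_le_of_hasMaj {X X' X₂ X₂' : Type} [Fintype X] [Fintype X'] [Fintype X₂] [Fintype X₂'] [DecidableEq X]
    [DecidableEq X'] {g : B6.Geometry} (blk₁ : X → g.Site) (blk₂ : X₂' → g.Site) (π₁ : X' → X) (π₂ : X₂' → X₂)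
    (P' : (X' → ℝ) →ₗ[ℝ] (X₂' → ℝ)) (P : (X → ℝ) →ₗ[ℝ] (X₂ → ℝ)) {K : g.Site → g.Site → ℝ}
    (h : HasMaj (BlockNorm.ofBlocks g blk₁) (BlockNorm.ofBlocks g blk₂) (idef (pull π₁) (pull π₂) P' P) K) (z : X) (x' : X₂') :
    |(∑ z' ∈ fibre π₁ z, P' (Pi.single z' 1) x') - P (Pi.single z 1) (π₂ x')| ≤ K (blk₂ x') (blk₁ z) := by
  rw [← idef_pull_pull_single_apply]
  exact entry_le_of_hasMaj blk₁ blk₂ h z x'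

end Summit.QuantumFields.YangMills.BalabanUVNodes.N15.DefectKernel
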